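/-
Copyright: public-audit package `pub-balaban` (b2b-balaban), seat pv28-g15. Released under Apache 2.0 like Mathlib.
-/
import Literature.MathematicalPhysics.QuantumFieldTheory.Balaban1983to89.T4PlaqDisjointFamilies
import Literature.MathematicalPhysics.QuantumFieldTheory.Balaban1983to89.T4MomentMayerStep

/-!
# T4 — caveat (SIZE-Σ) of the disjoint-fibre plug, answered structurally: on a plaquette-disjoint fibre the windowed
# Wilson conditional law is the PRODUCT of its one-link laws, so one-link inserts do not see the rest of the fibre,
# product inserts factorise, and the multi-link response of a local insert IS its one-link response

* Value = kernel certificate (exact algebra of the Wilson exponent on disjoint links + Fubini on the finite Haar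
  product; no estimate); NOT summit progress; NOT continuum; NOT Clay.  0 [cite], 0 [model]: everything here is
  [folklore]; NO printed sentence is asserted and nothing internally minted is cited (ABSOLUTE RULE).  Cell row
  T4-O3.E-iii-b-G7 (BL-window), lineage pv28, record `t4/T4-EST-O3Eiiib-G7.md`; this leaf answers item (SIZE-Σ) of
  GAPS G-pv28g15-1 for LOCAL inserts and pins every genuinely multi-link difficulty of the node on (N1-gen).
* THE QUESTION (SIZE-Σ).  `T4WilsonDisjointLinks.mem_respDom_of_wilson_disjoint` (p191493) puts an exterior `u` in
  the response domain of a plaquette-disjoint fibre `s` with the deviation functional `Σ_{b ∈ s} stapleDist b u₀ u`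
  and the small-field budget `ε + Σ_{b ∈ s} stapleDist b u₀ u ≤ 1/8` — a closeness requirement that grows with `#s`
  (`#s = #Site/2` on the parity classes of `T4PlaqDisjointFamilies`, p192201).  Is the sum over the fibre intrinsic?
* THE ANSWER TYPED HERE: NO — for local inserts it is an artefact of treating the fibre as one block.
  (1) PRODUCT FORMULA (§1).  With the ONE-LINK WEIGHT `λ_b(g) = 1[g ∈ W(u₀ b, S)]·e^{Re((q(g) − q(u b))·a_b(u))}`,
      `a_b(u) = wilsonDatum (−β) w u b` (a function of the `2(d−1)` STAPLES of `b` in `u`), the windowed Wilson density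
      on a plaquette-disjoint fibre factorises: `χ_{s,u₀,S}(u ←ₛ y)·e^{−βA_w(u ←ₛ y)} = e^{−βA_w(u)}·∏_{b ∈ s} λ_b(y_b)`
      (**`gibbs_updateFinset_eq_prod`**; the window is a product of indicators by definition and the exponent is the
      multi-affine expansion `T4WilsonDisjointLinks.mul_wilsonAction_updateFinset`).  `0 ≤ λ_b ≤ e^{2‖a_b‖}`,
      `λ_b ≥ e^{−2‖a_b‖}·1_W`, `λ_b` measurable and Haar-integrable, and the ONE-LINK MASS `m_b = ∫ λ_b dHaar > 0` for
      `S > 0` (`linkMass_pos`, from `T4CubeChartGnomonic.haar_gnoWindow_pos`).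
  (2) FUBINI (§2, Mathlib `integral_fintype_prod_eq_prod` on `T4MomentMayerStep.haarFibre`):
      `∫ χe^{−βA}(u ←ₛ y)·∏_b f_b(y_b) dHaar^s = e^{−βA_w(u)}·∏_b ∫ λ_b f_b dHaar` (`integral_gibbs_mul_prod`); in
      particular the tree's fibre integral is `∫dV⌈_s χe^{−βA} (u) = e^{−βA_w(u)}·∏_b m_b` (**`fibreIntegral_gibbs_eq_prod`**,
      via `T4MomentMayerStep.fibreIntegral_eq_integral`) and is POSITIVE AT EVERY EXTERIOR (`fibreIntegral_gibbs_pos`;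
      the lineage's earlier positivity `T4CubeChartGnomonic.fibreIntegral_windowDensity_mul_exp_pos` is at `u₀` only).
  (3) THE CONDITIONAL LAW (§3, §3b; `T4DressingDefect.condLaw/condMean`, `condMean_eq_div`).  For EVERY insert `F`,
      `E_s[F | u] = ∫ (∏_b λ_b(y_b))·F(u ←ₛ y) dHaar^s / ∏_b m_b` (`condMean_eq_div_prod`: the conditional law has the
      product density `∏_b λ_b/m_b`); at the level of measures, for `S > 0`,
      **`condLaw s χe^{−βA} u = Measure.pi (b ↦ linkLaw b)`** (`condLaw_eq_pi`, Mathlib `Measure.pi_eq` on boxes) with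
      the ONE-LINK LAW `linkLaw b = m_b⁻¹·λ_b·Haar`, a probability measure (`isProbabilityMeasure_linkLaw`): the link
      variables of a plaquette-disjoint fibre are conditionally INDEPENDENT.  Consequences in the tree's Bochner
      currency: PRODUCT INSERTS FACTORISE, `E_s[∏_b f_b(U b) | u] = ∏_b (∫ λ_b f_b)/m_b` (`condMean_prod`) and, over any
      sub-family `t ⊆ s`, `E_s[∏_{b ∈ t} f_b(U b) | u] = ∏_{b ∈ t} E_s[f_b(U b) | u]` (**`condMean_prod_eq_prod_condMean`**);
      A ONE-LINK INSERT DOES NOT SEE THE OTHER LINKS: for `b₀ ∈ s`, `E_s[f(U b₀) | u] = (∫ λ_{b₀} f)/m_{b₀}`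
      (**`condMean_oneLink`**) `= E_{{b₀}}[f(U b₀) | u]` (**`condMean_oneLink_eq_singleton`**) — exactly, uniformly in
      `#s`; ONE-LINK INSERTS ON DISTINCT LINKS ARE CONDITIONALLY UNCORRELATED (`condMean_mul_oneLink`: the truncated
      two-point function vanishes identically on the fibre).
  (4) LOCALITY IN THE EXTERIOR (§4).  `λ_b = e^{−Re(q(u b)·a_b)}·bare_b` with `bare_b` a function of `(u₀ b, S, a_b)`
      only, so every one-link quotient is a bare quotient (`div_linkMass_eq_bare`) and `E_s[f(U b₀) | u]` takes the SAME
      value at any two exteriors with the same Wilson datum at `b₀` — whatever all other links, inside or outside `s`,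
      do (**`condMean_oneLink_congr`**).
  (5) THE RESPONSE (§5).  Hence `E_s[f(U b₀) | u'] − E_s[f(U b₀) | u] = E_{{b₀}}[f(U b₀) | u'] − E_{{b₀}}[f(U b₀) | u]`
      (**`condMean_oneLink_sub_eq_singleton`**), `= 0` when the data at `b₀` agree (`condMean_oneLink_sub_eq_zero`): the
      covariance-response plug for a one-link insert through a plaquette-disjoint fibre of ANY size is the ONE-LINK plug
      at `s = {b₀}` — `T4WilsonDisjointLinks.mem_respDom_of_wilson_disjoint (plaqDisjoint_singleton b₀)` with
      `dev = stapleDist b₀ u₀` and the budget `ε + stapleDist b₀ u₀ u ≤ 1/8` of THAT link — and a product insert over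
      `t ⊆ s` is handled factor by factor; no `Σ_{b ∈ s}` ever enters.  (6) Named instances on the parity classes
      `dirClass μ₀ c` of p192201 (§6: `condMean_prod_dirClass`, `condMean_oneLink_dirClass`).
* THE LOCATED VERDICT FOR THE LINEAGE.  On plaquette-disjoint fibres the multi-link problem is a product of one-link
  problems: (SIZE-Σ) is dissolved for one-link and product inserts, and for a general insert `F` of the fibre the only
  coupling between links is through `F` itself (not through the law).  Everything genuinely multi-link in node
  T4-O3.E-iii-b-G7 therefore sits in (N1-gen) — fibres with SHARED plaquettes (every gauge-fixed fibre, by p192201's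
  ceiling), where `A_w` is NOT multi-affine link by link and the density does NOT factorise.

## Honest caveats

* WHAT THIS DOES NOT DO.  (a) No estimate is proved: the content is the exact product structure (algebra + Fubini);
  the one-link response bound itself is the lineage's plug (p190620 / p191493 at `s = {b}`), consumed by name in the
  docstrings only — this file does not restate or re-derive `respDom` membership.  (b) PLAQUETTE-DISJOINT fibres only
  (`PlaqDisjoint s`); with a shared plaquette the exponent acquires genuine cross terms and nothing here applies
  ((N1-gen) untouched).  (c) General (non-product) inserts `F` of the fibre: only the product-density formula
  `condMean_eq_div_prod` is given; a telescoping response bound `Σ_b (one-link response at b)·(sensitivity of F to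
  link b)` is NOT typed here.  (d) The window `χ_{s,u₀,S}` is the lineage's product gnomonic window (blind outside
  `s`); `S > 0` is needed exactly where a one-link mass is inverted (`linkMass_pos`); for `S ≤ 0` the one-link law is a
  junk value and the `S > 0` theorems do not speak.  (e) `k = 0` Wilson form, `SU(2)` quaternion model (RANK), as in
  the whole lineage; the measurability binder `hhm` is carried, not discharged.  (f) Imports: `T4PlaqDisjointFamilies`
  (the chain) and `T4MomentMayerStep` (for `haarFibre` / `fibreIntegral_eq_integral` by name; its only import
  `T4JointDressing` already lies in the chain's closure).  Nothing printed is read or asserted.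
-/


noncomputable section

open scoped Quaternion ENNReal
open _root_.MeasureTheory

namespace Literature.MathematicalPhysics.QuantumFieldTheory.Balaban1983to89.T4WilsonDisjointFactor

open Literature.MathematicalPhysics.QuantumLattice (su2Quat norm_su2Quat)
open Function (updateFinset)
open B15.BasicStep (fibreIntegral)
open T4DressingDefect (condMean condLaw fibreLaw condMean_eq_div)
open T4MomentMayerStep (haarFibre fibreIntegral_eq_integral)
open T4HaarSU2Translate (measurable_su2Quat continuous_su2Quat)
open T4CubeChartGnomonic (SU2 gnoWindow windowDensity measurable_windowDensity windowDensity_nonneg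
  measurableSet_gnoWindow haar_gnoWindow_pos)
open T4WilsonLinkAffine
open T4WilsonDatumBounds (abs_re_su2Quat_mul_le)
open T4WilsonDisjointLinks (PlaqDisjoint plaqDisjoint_singleton mul_wilsonAction_updateFinset)
open T4PlaqDisjointFamilies (dirClass plaqDisjoint_dirClass)
open Literature.MathematicalPhysics.QuantumFieldTheory.GaussianToolkit (lintegral_fintype_prod_eq_prod)

variable {P : Params} {j : ℕ} [DecidableEq (PBond P j)]

/-! ## §1  The one-link weight and the product formula for the windowed density on the fibre -/

section Weight

/-- **THE ONE-LINK WEIGHT** of the link `b` at the exterior `u` (chart centre `u₀`, window half-width `S`, inverse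
coupling `β`, plaquette weight `w`): `λ_b(g) = 1[g ∈ W(u₀ b, S)] · exp Re((q(g) − q(u b)) · a_b(u))` with the Wilson
datum `a_b(u) = wilsonDatum (−β) w u b` (a function of the STAPLES of `b` in `u` only). [folklore] -/
def linkWeight (u₀ u : GaugeField P j SU2) (S β w : ℝ) (b : PBond P j) (g : SU2) : ℝ :=
  (gnoWindow (u₀ b) S).indicator (fun _ => (1 : ℝ)) g *
    Real.exp (((su2Quat g - su2Quat (u b)) * wilsonDatum (-β) w u b).re)

/-- **THE ONE-LINK MASS** `m_b = ∫ λ_b dHaar`. [folklore] -/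
def linkMass (u₀ u : GaugeField P j SU2) (S β w : ℝ) (b : PBond P j) : ℝ :=
  ∫ g, linkWeight u₀ u S β w b g ∂(HaarData.haar : Measure SU2)

variable {u₀ u : GaugeField P j SU2} {S β w : ℝ} {b : PBond P j}

/-- `λ_b ≥ 0`. [folklore] -/
theorem linkWeight_nonneg (g : SU2) : 0 ≤ linkWeight u₀ u S β w b g :=
  mul_nonneg (Set.indicator_nonneg (fun _ _ => zero_le_one) _) (Real.exp_nonneg _)

/-- The exponent is bounded: `|Re((q(g) − q(u b))·a_b)| ≤ 2‖a_b‖`. [folklore] -/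
theorem abs_re_sub_mul_le (u : GaugeField P j SU2) (β w : ℝ) (b : PBond P j) (g : SU2) :
    |((su2Quat g - su2Quat (u b)) * wilsonDatum (-β) w u b).re| ≤ 2 * ‖wilsonDatum (-β) w u b‖ := by
  rw [sub_mul, Quaternion.re_sub]
  have h1 := abs_re_su2Quat_mul_le g (wilsonDatum (-β) w u b)
  have h2 := abs_re_su2Quat_mul_le (u b) (wilsonDatum (-β) w u b)
  have h3 := abs_sub _ _ |>.trans (add_le_add h1 h2)
  linarith

/-- `λ_b ≤ e^{2‖a_b‖}`. [folklore] -/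
theorem linkWeight_le (g : SU2) : linkWeight u₀ u S β w b g ≤ Real.exp (2 * ‖wilsonDatum (-β) w u b‖) := by
  have h1 : (gnoWindow (u₀ b) S).indicator (fun _ => (1 : ℝ)) g ≤ 1 :=
    Set.indicator_apply_le' (fun _ => le_rfl) (fun _ => zero_le_one)
  have h2 : Real.exp (((su2Quat g - su2Quat (u b)) * wilsonDatum (-β) w u b).re)
      ≤ Real.exp (2 * ‖wilsonDatum (-β) w u b‖) :=
    Real.exp_le_exp.2 (abs_le.1 (abs_re_sub_mul_le u β w b g)).2
  exact (mul_le_of_le_one_left (Real.exp_nonneg _) h1).trans h2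

/-- On the window `λ_b ≥ e^{−2‖a_b‖}`; off it `λ_b = 0`: `λ_b ≥ e^{−2‖a_b‖}·1_W`. [folklore] -/
theorem indicator_le_linkWeight (g : SU2) :
    (gnoWindow (u₀ b) S).indicator (fun _ => Real.exp (-(2 * ‖wilsonDatum (-β) w u b‖))) g
      ≤ linkWeight u₀ u S β w b g := by
  unfold linkWeight
  by_cases hg : g ∈ gnoWindow (u₀ b) S
  · rw [Set.indicator_of_mem hg, Set.indicator_of_mem hg, one_mul]
    exact Real.exp_le_exp.2 (abs_le.1 (abs_re_sub_mul_le u β w b g)).1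
  · rw [Set.indicator_of_notMem hg, Set.indicator_of_notMem hg, zero_mul]

/-- `λ_b` is measurable. [folklore] -/
theorem measurable_linkWeight : Measurable (linkWeight u₀ u S β w b) := by
  refine (measurable_const.indicator measurableSet_gnoWindow).mul (Real.measurable_exp.comp ?_)
  have hc : Continuous fun g : SU2 => ((su2Quat g - su2Quat (u b)) * wilsonDatum (-β) w u b).re :=
    Quaternion.continuous_re.comp ((continuous_su2Quat.sub continuous_const).mul continuous_const)
  exact hc.measurable

/-- `λ_b` is Haar-integrable (bounded and measurable on a probability space). [folklore] -/
theorem integrable_linkWeight : Integrable (linkWeight u₀ u S β w b) (HaarData.haar : Measure SU2) :=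
  Integrable.of_bound measurable_linkWeight.aestronglyMeasurable (Real.exp (2 * ‖wilsonDatum (-β) w u b‖))
    (Filter.Eventually.of_forall fun g => by
      rw [Real.norm_of_nonneg (linkWeight_nonneg g)]
      exact linkWeight_le g)

/-- … and so is `λ_b · f` for a bounded measurable insert. [folklore] -/
theorem integrable_linkWeight_mul {f : SU2 → ℝ} (hf : Measurable f) {M : ℝ} (hM : ∀ g, |f g| ≤ M) :
    Integrable (fun g => linkWeight u₀ u S β w b g * f g) (HaarData.haar : Measure SU2) :=
  Integrable.of_bound (measurable_linkWeight.mul hf).aestronglyMeasurable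
    (Real.exp (2 * ‖wilsonDatum (-β) w u b‖) * M) (Filter.Eventually.of_forall fun g => by
      rw [norm_mul, Real.norm_of_nonneg (linkWeight_nonneg g), Real.norm_eq_abs]
      exact mul_le_mul (linkWeight_le g) (hM g) (abs_nonneg _) (Real.exp_nonneg _))

/-- **THE ONE-LINK MASS IS POSITIVE** for `S > 0`: `m_b ≥ e^{−2‖a_b‖}·Haar(W(u₀ b, S)) > 0`. [folklore] -/
theorem linkMass_pos (hS : 0 < S) : 0 < linkMass u₀ u S β w b := by
  have hW : 0 < (HaarData.haar : Measure SU2).real (gnoWindow (u₀ b) S) :=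
    ENNReal.toReal_pos (haar_gnoWindow_pos (u₀ b) hS).ne' (measure_ne_top _ _)
  have hle : ∫ g, (gnoWindow (u₀ b) S).indicator (fun _ => Real.exp (-(2 * ‖wilsonDatum (-β) w u b‖))) g
      ∂(HaarData.haar : Measure SU2) ≤ linkMass u₀ u S β w b :=
    integral_mono ((integrable_const _).indicator measurableSet_gnoWindow) integrable_linkWeight
      fun g => indicator_le_linkWeight g
  rw [integral_indicator_const _ measurableSet_gnoWindow, smul_eq_mul] at hle
  exact lt_of_lt_of_le (mul_pos hW (Real.exp_pos _)) hle

/-- `m_b ≠ 0` (`S > 0`). [folklore] -/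
theorem linkMass_ne_zero (hS : 0 < S) : linkMass u₀ u S β w b ≠ 0 := (linkMass_pos hS).ne'

/-- **LOCALITY OF THE WEIGHT IN THE EXTERIOR**: `λ_b` depends on `u` only through `u b` and the Wilson datum of `b`
(i.e. the staples of `b`). [folklore] -/
theorem linkWeight_congr {u' : GaugeField P j SU2} (hb : u' b = u b)
    (hD : wilsonDatum (-β) w u' b = wilsonDatum (-β) w u b) : linkWeight u₀ u' S β w b = linkWeight u₀ u S β w b := by
  funext g; simp only [linkWeight, hb, hD]

/-- … and so does `m_b`. [folklore] -/
theorem linkMass_congr {u' : GaugeField P j SU2} (hb : u' b = u b)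
    (hD : wilsonDatum (-β) w u' b = wilsonDatum (-β) w u b) : linkMass u₀ u' S β w b = linkMass u₀ u S β w b := by
  unfold linkMass; rw [linkWeight_congr hb hD]

end Weight

section Fibre

variable {s : Finset (PBond P j)} {u₀ u : GaugeField P j SU2} {S β w : ℝ}

/-- The fibre variable of a link of `s` under the update. [folklore] -/
theorem updateFinset_apply_coe {G : Type*} (u : GaugeField P j G) (y : ↥s → G) (b : ↥s) :
    updateFinset u s y b = y b := by
  unfold updateFinset
  exact dif_pos b.2

/-- The product window on the fibre through `s` at ANY exterior is the product of the one-link indicators. [folklore] -/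
theorem windowDensity_updateFinset_eq_prod (u : GaugeField P j SU2) (y : ↥s → SU2) :
    windowDensity s u₀ S (updateFinset u s y) = ∏ b : ↥s, (gnoWindow (u₀ b) S).indicator (fun _ => (1 : ℝ)) (y b) := by
  show (∏ b ∈ s, (gnoWindow (u₀ b) S).indicator (fun _ => (1 : ℝ)) (updateFinset u s y b)) = _
  rw [← Finset.prod_coe_sort s]
  exact Finset.prod_congr rfl fun b _ => by rw [updateFinset_apply_coe]

/-- **THE PRODUCT FORMULA.**  On a plaquette-disjoint fibre the windowed Wilson density factorises over the links:
`χ_{s,u₀,S}(u ←ₛ y) · e^{−β A_w(u ←ₛ y)} = e^{−β A_w(u)} · ∏_{b ∈ s} λ_b(y_b)` (`mul_wilsonAction_updateFinset`).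
[folklore] -/
theorem gibbs_updateFinset_eq_prod (hdis : PlaqDisjoint s) (y : ↥s → SU2) :
    windowDensity s u₀ S (updateFinset u s y) * Real.exp (-β * wilsonAction w (updateFinset u s y))
      = Real.exp (-β * wilsonAction w u) * ∏ b : ↥s, linkWeight u₀ u S β w b (y b) := by
  rw [windowDensity_updateFinset_eq_prod, mul_wilsonAction_updateFinset hdis (-β) w y, Real.exp_add, Real.exp_sum]
  unfold linkWeight
  rw [Finset.prod_mul_distrib]
  ring

/-! ## §2  Fubini: fibre integrals of product inserts are products of one-link Haar integrals -/

/-- **FUBINI FOR PRODUCT INSERTS.**  `∫ χe^{−βA}(u ←ₛ y) · ∏_b f_b(y_b) dHaar^s(y) = e^{−βA_w(u)} · ∏_b ∫ λ_b f_b dHaar`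
(Mathlib `integral_fintype_prod_eq_prod`; no integrability hypotheses). [folklore] -/
theorem integral_gibbs_mul_prod (hdis : PlaqDisjoint s) (f : ↥s → SU2 → ℝ) :
    ∫ y, windowDensity s u₀ S (updateFinset u s y) * Real.exp (-β * wilsonAction w (updateFinset u s y))
        * ∏ b : ↥s, f b (y b) ∂haarFibre SU2 s
      = Real.exp (-β * wilsonAction w u)
          * ∏ b : ↥s, ∫ g, linkWeight u₀ u S β w b g * f b g ∂(HaarData.haar : Measure SU2) := by
  simp_rw [gibbs_updateFinset_eq_prod hdis, mul_assoc, ← Finset.prod_mul_distrib]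
  rw [integral_const_mul]
  congr 1
  exact integral_fintype_prod_eq_prod (𝕜 := ℝ) fun (b : ↥s) (g : SU2) => linkWeight u₀ u S β w b g * f b g

/-- The special case `f ≡ 1`: `∫ χe^{−βA}(u ←ₛ y) dHaar^s(y) = e^{−βA_w(u)} · ∏_b m_b`. [folklore] -/
theorem integral_gibbs (hdis : PlaqDisjoint s) :
    ∫ y, windowDensity s u₀ S (updateFinset u s y) * Real.exp (-β * wilsonAction w (updateFinset u s y))
        ∂haarFibre SU2 s
      = Real.exp (-β * wilsonAction w u) * ∏ b : ↥s, linkMass u₀ u S β w b := by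
  have h := integral_gibbs_mul_prod (u₀ := u₀) (u := u) (S := S) (β := β) (w := w) hdis fun _ _ => (1 : ℝ)
  simp only [Finset.prod_const_one, mul_one] at h
  exact h

omit [DecidableEq (PBond P j)] in
/-- The windowed Wilson density is measurable (binder `hhm` as in the lineage's plugs). [folklore] -/
theorem measurable_gibbs (hhm : Measurable fun U : GaugeField P j SU2 => -β * wilsonAction w U) :
    Measurable fun U => windowDensity s u₀ S U * Real.exp (-β * wilsonAction w U) :=
  (measurable_windowDensity s u₀ S).mul (Real.measurable_exp.comp hhm)

omit [DecidableEq (PBond P j)] in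
/-- … and non-negative. [folklore] -/
theorem gibbs_nonneg (U : GaugeField P j SU2) : 0 ≤ windowDensity s u₀ S U * Real.exp (-β * wilsonAction w U) :=
  mul_nonneg (windowDensity_nonneg U) (Real.exp_nonneg _)

/-- **THE FIBRE INTEGRAL FACTORISES**: `∫dV⌈_s χe^{−βA} (u) = e^{−βA_w(u)} · ∏_{b ∈ s} m_b`. [folklore] -/
theorem fibreIntegral_gibbs_eq_prod (hdis : PlaqDisjoint s)
    (hhm : Measurable fun U : GaugeField P j SU2 => -β * wilsonAction w U) :
    fibreIntegral s (fun U => windowDensity s u₀ S U * Real.exp (-β * wilsonAction w U)) u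
      = Real.exp (-β * wilsonAction w u) * ∏ b : ↥s, linkMass u₀ u S β w b := by
  rw [fibreIntegral_eq_integral s (measurable_gibbs hhm) gibbs_nonneg u]
  exact integral_gibbs hdis

/-- Hence the fibre integral is POSITIVE at EVERY exterior (`S > 0`; compare
`T4CubeChartGnomonic.fibreIntegral_windowDensity_mul_exp_pos`, stated at the reference exterior under a global bound
on the exponent). [folklore] -/
theorem fibreIntegral_gibbs_pos (hdis : PlaqDisjoint s) (hS : 0 < S)
    (hhm : Measurable fun U : GaugeField P j SU2 => -β * wilsonAction w U) :
    0 < fibreIntegral s (fun U => windowDensity s u₀ S U * Real.exp (-β * wilsonAction w U)) u := by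
  rw [fibreIntegral_gibbs_eq_prod hdis hhm]
  exact mul_pos (Real.exp_pos _) (Finset.prod_pos fun b _ => linkMass_pos hS)

/-! ## §3  The conditional law: product density, product inserts, one-link inserts -/

/-- **THE CONDITIONAL LAW HAS THE PRODUCT DENSITY `∏_b λ_b(y_b)/m_b`** with respect to `Haar^s`: for EVERY insert
`F`, `E[F | u] = ∫ (∏_b λ_b(y_b)) · F(u ←ₛ y) dHaar^s(y) / ∏_b m_b` (the global factor `e^{−βA_w(u)}` cancels; no
positivity needed — both sides are `0` in the degenerate case). [folklore] -/
theorem condMean_eq_div_prod (hdis : PlaqDisjoint s)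
    (hhm : Measurable fun U : GaugeField P j SU2 => -β * wilsonAction w U) (F : Density P j SU2) :
    condMean s (fun U => windowDensity s u₀ S U * Real.exp (-β * wilsonAction w U)) F u
      = (∫ y, (∏ b : ↥s, linkWeight u₀ u S β w b (y b)) * F (updateFinset u s y) ∂haarFibre SU2 s)
          / ∏ b : ↥s, linkMass u₀ u S β w b := by
  rw [condMean_eq_div s (measurable_gibbs hhm) gibbs_nonneg F u, fibreIntegral_gibbs_eq_prod hdis hhm]
  change (∫ y, _ ∂haarFibre SU2 s) / _ = _
  simp_rw [gibbs_updateFinset_eq_prod hdis, mul_assoc]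
  rw [integral_const_mul, mul_div_mul_left _ _ (Real.exp_pos _).ne']

/-- **PRODUCT INSERTS FACTORISE**: `E[∏_b f_b(U b) | u] = ∏_b (∫ λ_b f_b dHaar) / m_b`. [folklore] -/
theorem condMean_prod (hdis : PlaqDisjoint s)
    (hhm : Measurable fun U : GaugeField P j SU2 => -β * wilsonAction w U) (f : ↥s → SU2 → ℝ) :
    condMean s (fun U => windowDensity s u₀ S U * Real.exp (-β * wilsonAction w U))
        (fun U => ∏ b : ↥s, f b (U b)) u
      = ∏ b : ↥s, (∫ g, linkWeight u₀ u S β w b g * f b g ∂(HaarData.haar : Measure SU2))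
          / linkMass u₀ u S β w b := by
  rw [condMean_eq_div s (measurable_gibbs hhm) gibbs_nonneg _ u, fibreIntegral_gibbs_eq_prod hdis hhm]
  change (∫ y, _ ∂haarFibre SU2 s) / _ = _
  simp_rw [updateFinset_apply_coe]
  rw [integral_gibbs_mul_prod hdis, mul_div_mul_left _ _ (Real.exp_pos _).ne', Finset.prod_div_distrib]

/-- **A ONE-LINK INSERT DOES NOT SEE THE OTHER LINKS OF THE FIBRE**: for `b₀ ∈ s`,
`E[f(U b₀) | u] = ∫ λ_{b₀} f dHaar / m_{b₀}` — exactly, uniformly in `#s`. [folklore] -/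
theorem condMean_oneLink (hdis : PlaqDisjoint s) (hS : 0 < S)
    (hhm : Measurable fun U : GaugeField P j SU2 => -β * wilsonAction w U) {b₀ : PBond P j} (hb₀ : b₀ ∈ s)
    (f : SU2 → ℝ) :
    condMean s (fun U => windowDensity s u₀ S U * Real.exp (-β * wilsonAction w U)) (fun U => f (U b₀)) u
      = (∫ g, linkWeight u₀ u S β w b₀ g * f g ∂(HaarData.haar : Measure SU2)) / linkMass u₀ u S β w b₀ := by
  classical
  let F : ↥s → SU2 → ℝ := fun b => if (b : PBond P j) = b₀ then f else fun _ => 1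
  have hF : (fun U : GaugeField P j SU2 => ∏ b : ↥s, F b (U b)) = fun U => f (U b₀) := by
    funext U
    rw [Finset.prod_eq_single ⟨b₀, hb₀⟩ (fun b _ hb => by
      have hb' : (b : PBond P j) ≠ b₀ := fun h => hb (Subtype.ext h)
      simp only [F, if_neg hb']) (fun h => absurd (Finset.mem_univ _) h)]
    simp only [F, if_pos rfl]
  rw [← hF, condMean_prod hdis hhm F]
  rw [Finset.prod_eq_single ⟨b₀, hb₀⟩ (fun b _ hb => by
    have hb' : (b : PBond P j) ≠ b₀ := fun h => hb (Subtype.ext h)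
    simp only [F, if_neg hb', mul_one]
    exact div_self (linkMass_ne_zero hS)) (fun h => absurd (Finset.mem_univ _) h)]
  simp only [F, if_pos rfl]

/-- **… AND EQUALS ITS SINGLETON-FIBRE CONDITIONAL MEAN** at the same exterior: conditioning on the plaquette-disjoint
fibre `s ∋ b₀` or on the one link `b₀` gives the same expectation of `f(U b₀)`. [folklore] -/
theorem condMean_oneLink_eq_singleton (hdis : PlaqDisjoint s) (hS : 0 < S)
    (hhm : Measurable fun U : GaugeField P j SU2 => -β * wilsonAction w U) {b₀ : PBond P j} (hb₀ : b₀ ∈ s)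
    (f : SU2 → ℝ) :
    condMean s (fun U => windowDensity s u₀ S U * Real.exp (-β * wilsonAction w U)) (fun U => f (U b₀)) u
      = condMean {b₀} (fun U => windowDensity {b₀} u₀ S U * Real.exp (-β * wilsonAction w U))
          (fun U => f (U b₀)) u := by
  rw [condMean_oneLink hdis hS hhm hb₀ f,
    condMean_oneLink (plaqDisjoint_singleton b₀) hS hhm (Finset.mem_singleton_self b₀) f]

/-- **PRODUCT INSERTS OVER A SUB-FAMILY factorise into ONE-LINK conditional means**: for `t ⊆ s`,
`E[∏_{b ∈ t} f_b(U b) | u] = ∏_{b ∈ t} E[f_b(U b) | u]` — the links of a plaquette-disjoint fibre are conditionally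
INDEPENDENT. [folklore] -/
theorem condMean_prod_eq_prod_condMean (hdis : PlaqDisjoint s) (hS : 0 < S)
    (hhm : Measurable fun U : GaugeField P j SU2 => -β * wilsonAction w U) {t : Finset (PBond P j)} (ht : t ⊆ s)
    (f : PBond P j → SU2 → ℝ) :
    condMean s (fun U => windowDensity s u₀ S U * Real.exp (-β * wilsonAction w U))
        (fun U => ∏ b ∈ t, f b (U b)) u
      = ∏ b ∈ t, condMean s (fun U => windowDensity s u₀ S U * Real.exp (-β * wilsonAction w U))
          (fun U => f b (U b)) u := by
  classical
  let F : ↥s → SU2 → ℝ := fun b => if (b : PBond P j) ∈ t then f b else fun _ => 1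
  have hF : (fun U : GaugeField P j SU2 => ∏ b : ↥s, F b (U b)) = fun U => ∏ b ∈ t, f b (U b) := by
    funext U
    have h1 : (∏ b : ↥s, F b (U b)) = ∏ b ∈ s, (if b ∈ t then f b (U b) else 1) := by
      rw [← Finset.prod_coe_sort s]
      refine Finset.prod_congr rfl fun b _ => ?_
      by_cases hb : (b : PBond P j) ∈ t
      · simp only [F, if_pos hb]
      · simp only [F, if_neg hb]
    rw [h1, Finset.prod_ite_mem, Finset.inter_eq_right.2 ht]
  rw [← hF, condMean_prod hdis hhm F]
  have h2 : (∏ b : ↥s, (∫ g, linkWeight u₀ u S β w b g * F b g ∂(HaarData.haar : Measure SU2))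
      / linkMass u₀ u S β w b)
      = ∏ b ∈ s, (if b ∈ t then (∫ g, linkWeight u₀ u S β w b g * f b g ∂(HaarData.haar : Measure SU2))
          / linkMass u₀ u S β w b else 1) := by
    rw [← Finset.prod_coe_sort s]
    refine Finset.prod_congr rfl fun b _ => ?_
    by_cases hb : (b : PBond P j) ∈ t
    · simp only [F, if_pos hb]
    · simp only [F, if_neg hb, mul_one]
      exact div_self (linkMass_ne_zero hS)
  rw [h2, Finset.prod_ite_mem, Finset.inter_eq_right.2 ht]
  exact Finset.prod_congr rfl fun b hb => (condMean_oneLink hdis hS hhm (ht hb) (f b)).symm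

/-- **ONE-LINK INSERTS ON DISTINCT LINKS ARE CONDITIONALLY UNCORRELATED**: for `b₁ ≠ b₂` in `s`,
`E[f₁(U b₁)·f₂(U b₂) | u] = E[f₁(U b₁) | u] · E[f₂(U b₂) | u]` — the truncated two-point function of one-link
inserts vanishes identically on a plaquette-disjoint fibre. [folklore] -/
theorem condMean_mul_oneLink (hdis : PlaqDisjoint s) (hS : 0 < S)
    (hhm : Measurable fun U : GaugeField P j SU2 => -β * wilsonAction w U) {b₁ b₂ : PBond P j} (hb₁ : b₁ ∈ s)
    (hb₂ : b₂ ∈ s) (hne : b₁ ≠ b₂) (f₁ f₂ : SU2 → ℝ) :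
    condMean s (fun U => windowDensity s u₀ S U * Real.exp (-β * wilsonAction w U))
        (fun U => f₁ (U b₁) * f₂ (U b₂)) u
      = condMean s (fun U => windowDensity s u₀ S U * Real.exp (-β * wilsonAction w U)) (fun U => f₁ (U b₁)) u
        * condMean s (fun U => windowDensity s u₀ S U * Real.exp (-β * wilsonAction w U))
            (fun U => f₂ (U b₂)) u := by
  classical
  let f : PBond P j → SU2 → ℝ := fun b => if b = b₁ then f₁ else f₂
  have ht : ({b₁, b₂} : Finset (PBond P j)) ⊆ s :=
    Finset.insert_subset hb₁ (Finset.singleton_subset_iff.2 hb₂)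
  have h := condMean_prod_eq_prod_condMean (u₀ := u₀) (u := u) (S := S) (β := β) (w := w) hdis hS hhm ht f
  simpa [Finset.prod_pair hne, f, hne.symm] using h

/-! ## §3b  The same at the level of LAWS: the conditional law is the product of the one-link laws -/

omit [DecidableEq (PBond P j)] in
/-- `∫⁻ λ_b dHaar = m_b` (as extended non-negative reals). [folklore] -/
theorem lintegral_linkWeight [DecidableEq (PBond P j)] (b : PBond P j) :
    ∫⁻ g, ENNReal.ofReal (linkWeight u₀ u S β w b g) ∂(HaarData.haar : Measure SU2)
      = ENNReal.ofReal (linkMass u₀ u S β w b) :=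
  (ofReal_integral_eq_lintegral_ofReal integrable_linkWeight
    (Filter.Eventually.of_forall fun g => linkWeight_nonneg g)).symm

/-- **THE ONE-LINK LAW** of the link `b` at the exterior `u`: the normalised Haar measure with density `λ_b/m_b`
(a probability measure on `SU(2)` for `S > 0`; the junk value for `S ≤ 0` is irrelevant here). [folklore] -/
def linkLaw (u₀ u : GaugeField P j SU2) (S β w : ℝ) (b : PBond P j) : Measure SU2 :=
  (ENNReal.ofReal (linkMass u₀ u S β w b))⁻¹ •
    (HaarData.haar : Measure SU2).withDensity fun g => ENNReal.ofReal (linkWeight u₀ u S β w b g)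

/-- The one-link law on a measurable set. [folklore] -/
theorem linkLaw_apply (b : PBond P j) {A : Set SU2} (hA : MeasurableSet A) :
    linkLaw u₀ u S β w b A
      = (ENNReal.ofReal (linkMass u₀ u S β w b))⁻¹
          * ∫⁻ g in A, ENNReal.ofReal (linkWeight u₀ u S β w b g) ∂(HaarData.haar : Measure SU2) := by
  rw [linkLaw, Measure.smul_apply, withDensity_apply _ hA, smul_eq_mul]

/-- The one-link law is a probability measure (`S > 0`). [folklore] -/
theorem isProbabilityMeasure_linkLaw (hS : 0 < S) (b : PBond P j) :
    IsProbabilityMeasure (linkLaw u₀ u S β w b) := by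
  refine ⟨?_⟩
  rw [linkLaw_apply b MeasurableSet.univ, Measure.restrict_univ, lintegral_linkWeight]
  exact ENNReal.inv_mul_cancel (ENNReal.ofReal_pos.2 (linkMass_pos hS)).ne' ENNReal.ofReal_ne_top

/-- The fibre law of the windowed Wilson density on a BOX of the plaquette-disjoint fibre:
`fibreLaw(∏_b A_b) = e^{−βA_w(u)} · ∏_b ∫⁻_{A_b} λ_b dHaar`. [folklore] -/
theorem fibreLaw_gibbs_pi (hdis : PlaqDisjoint s) {A : ↥s → Set SU2} (hA : ∀ b, MeasurableSet (A b)) :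
    fibreLaw s (fun U => windowDensity s u₀ S U * Real.exp (-β * wilsonAction w U)) u (Set.pi Set.univ A)
      = ENNReal.ofReal (Real.exp (-β * wilsonAction w u))
          * ∏ b : ↥s, ∫⁻ g in A b, ENNReal.ofReal (linkWeight u₀ u S β w b g) ∂(HaarData.haar : Measure SU2) := by
  rw [fibreLaw, withDensity_apply _ (MeasurableSet.univ_pi hA), Measure.restrict_pi_pi]
  have hpt : (fun y : ↥s → SU2 => ENNReal.ofReal
      (windowDensity s u₀ S (updateFinset u s y) * Real.exp (-β * wilsonAction w (updateFinset u s y))))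
      = fun y => ENNReal.ofReal (Real.exp (-β * wilsonAction w u))
          * ∏ b : ↥s, ENNReal.ofReal (linkWeight u₀ u S β w b (y b)) := by
    funext y
    rw [gibbs_updateFinset_eq_prod hdis, ENNReal.ofReal_mul (Real.exp_nonneg _),
      ENNReal.ofReal_prod_of_nonneg fun b _ => linkWeight_nonneg (y b)]
  rw [hpt, lintegral_const_mul' _ _ ENNReal.ofReal_ne_top]
  congr 1
  exact lintegral_fintype_prod_eq_prod (fun b : ↥s => (HaarData.haar : Measure SU2).restrict (A b))
    fun b => ENNReal.measurable_ofReal.comp measurable_linkWeight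

/-- Its total mass: `fibreLaw(univ) = e^{−βA_w(u)} · ∏_b m_b`. [folklore] -/
theorem fibreLaw_gibbs_univ (hdis : PlaqDisjoint s) :
    fibreLaw s (fun U => windowDensity s u₀ S U * Real.exp (-β * wilsonAction w U)) u Set.univ
      = ENNReal.ofReal (Real.exp (-β * wilsonAction w u))
          * ∏ b : ↥s, ENNReal.ofReal (linkMass u₀ u S β w b) := by
  rw [← Set.pi_univ Set.univ, fibreLaw_gibbs_pi hdis fun _ => MeasurableSet.univ]
  simp_rw [Measure.restrict_univ, lintegral_linkWeight]

/-- **THE CONDITIONAL LAW IS THE PRODUCT OF THE ONE-LINK LAWS** (`S > 0`): under `condLaw s χe^{−βA} u` on a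
plaquette-disjoint fibre the link variables `(y_b)_{b ∈ s}` are INDEPENDENT, `y_b ∼ linkLaw b`. [folklore] -/
theorem condLaw_eq_pi (hdis : PlaqDisjoint s) (hS : 0 < S) :
    condLaw s (fun U => windowDensity s u₀ S U * Real.exp (-β * wilsonAction w U)) u
      = Measure.pi fun b : ↥s => linkLaw u₀ u S β w (b : PBond P j) := by
  have hP : ∀ b : PBond P j, IsProbabilityMeasure (linkLaw u₀ u S β w b) :=
    fun b => isProbabilityMeasure_linkLaw (u₀ := u₀) (u := u) (β := β) (w := w) hS b
  haveI : ∀ b : ↥s, SigmaFinite (linkLaw u₀ u S β w (b : PBond P j)) := fun b => by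
    haveI := hP b; infer_instance
  symm
  refine Measure.pi_eq fun A hA => ?_
  have he0 : ENNReal.ofReal (Real.exp (-β * wilsonAction w u)) ≠ 0 := (ENNReal.ofReal_pos.2 (Real.exp_pos _)).ne'
  have hM : (∏ b : ↥s, ENNReal.ofReal (linkMass u₀ u S β w b))⁻¹
      = ∏ b : ↥s, (ENNReal.ofReal (linkMass u₀ u S β w b))⁻¹ :=
    ENNReal.prod_inv_distrib fun _ _ _ _ _ => Or.inr ENNReal.ofReal_ne_top
  rw [condLaw, Measure.smul_apply, smul_eq_mul, fibreLaw_gibbs_univ hdis, fibreLaw_gibbs_pi hdis hA,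
    ENNReal.mul_inv (Or.inl he0) (Or.inl ENNReal.ofReal_ne_top), mul_mul_mul_comm,
    ENNReal.inv_mul_cancel he0 ENNReal.ofReal_ne_top, one_mul, hM, ← Finset.prod_mul_distrib]
  exact Finset.prod_congr rfl fun b _ => (linkLaw_apply (b : PBond P j) (hA b)).symm

/-! ## §4  Locality in the exterior: the one-link conditional mean depends on `u` only through the Wilson datum
of that link (its staples) — not on `u b₀`, not on any other link inside or outside the fibre -/

/-- THE BARE WEIGHT of a window centre `g₀`, half-width `S` and datum `a`: `1[g ∈ W(g₀,S)]·e^{Re(q(g)·a)}`. [folklore] -/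
def bareWeight (g₀ : SU2) (S : ℝ) (a : ℍ) (g : SU2) : ℝ :=
  (gnoWindow g₀ S).indicator (fun _ => (1 : ℝ)) g * Real.exp ((su2Quat g * a).re)

/-- `λ_b = e^{−Re(q(u b)·a_b)} · bare_b`: the exterior value `u b` enters only through a constant factor. [folklore] -/
theorem linkWeight_eq_mul_bareWeight (b : PBond P j) (g : SU2) :
    linkWeight u₀ u S β w b g
      = Real.exp (-(su2Quat (u b) * wilsonDatum (-β) w u b).re)
          * bareWeight (u₀ b) S (wilsonDatum (-β) w u b) g := by
  unfold linkWeight bareWeight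
  rw [sub_mul, Quaternion.re_sub, sub_eq_add_neg, Real.exp_add]
  ring

/-- Hence every ONE-LINK QUOTIENT is a bare quotient: `(∫ λ_b f)/m_b = (∫ bare_b f)/(∫ bare_b)`. [folklore] -/
theorem div_linkMass_eq_bare (b : PBond P j) (f : SU2 → ℝ) :
    (∫ g, linkWeight u₀ u S β w b g * f g ∂(HaarData.haar : Measure SU2)) / linkMass u₀ u S β w b
      = (∫ g, bareWeight (u₀ b) S (wilsonDatum (-β) w u b) g * f g ∂(HaarData.haar : Measure SU2))
          / ∫ g, bareWeight (u₀ b) S (wilsonDatum (-β) w u b) g ∂(HaarData.haar : Measure SU2) := by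
  unfold linkMass
  simp_rw [linkWeight_eq_mul_bareWeight, mul_assoc]
  rw [integral_const_mul, integral_const_mul, mul_div_mul_left _ _ (Real.exp_pos _).ne']

/-- **LOCALITY OF THE ONE-LINK CONDITIONAL MEAN.**  On a plaquette-disjoint fibre `s ∋ b₀` the conditional mean of
`f(U b₀)` takes the same value at any two exteriors with the same Wilson datum at `b₀` (the same `2(d−1)` staples of
`b₀`) — whatever ALL the other links, inside or outside `s`, do. [folklore] -/
theorem condMean_oneLink_congr (hdis : PlaqDisjoint s) (hS : 0 < S)
    (hhm : Measurable fun U : GaugeField P j SU2 => -β * wilsonAction w U) {b₀ : PBond P j} (hb₀ : b₀ ∈ s)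
    (f : SU2 → ℝ) {u' : GaugeField P j SU2} (hD : wilsonDatum (-β) w u' b₀ = wilsonDatum (-β) w u b₀) :
    condMean s (fun U => windowDensity s u₀ S U * Real.exp (-β * wilsonAction w U)) (fun U => f (U b₀)) u'
      = condMean s (fun U => windowDensity s u₀ S U * Real.exp (-β * wilsonAction w U)) (fun U => f (U b₀)) u := by
  rw [condMean_oneLink hdis hS hhm hb₀ f, condMean_oneLink hdis hS hhm hb₀ f, div_linkMass_eq_bare,
    div_linkMass_eq_bare, hD]

/-! ## §5  The response of a one-link insert through a plaquette-disjoint fibre IS the one-link response -/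

/-- **THE MULTI-LINK RESPONSE OF A ONE-LINK INSERT IS ITS ONE-LINK RESPONSE.**  For `b₀ ∈ s`, `s` plaquette-disjoint,
and any two exteriors `u`, `u'`: `E_s[f(U b₀) | u'] − E_s[f(U b₀) | u] = E_{{b₀}}[f(U b₀) | u'] − E_{{b₀}}[f(U b₀) | u]`
— so the covariance-response plug is to be applied at `s = {b₀}` with `dev = stapleDist b₀ u₀`
(`T4WilsonDisjointLinks.mem_respDom_of_wilson_disjoint (plaqDisjoint_singleton b₀)`), uniformly in `#s`: for
one-link (and, by §3, product) inserts there is NO sum over the fibre. [folklore] -/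
theorem condMean_oneLink_sub_eq_singleton (hdis : PlaqDisjoint s) (hS : 0 < S)
    (hhm : Measurable fun U : GaugeField P j SU2 => -β * wilsonAction w U) {b₀ : PBond P j} (hb₀ : b₀ ∈ s)
    (f : SU2 → ℝ) (u' : GaugeField P j SU2) :
    condMean s (fun U => windowDensity s u₀ S U * Real.exp (-β * wilsonAction w U)) (fun U => f (U b₀)) u'
        - condMean s (fun U => windowDensity s u₀ S U * Real.exp (-β * wilsonAction w U)) (fun U => f (U b₀)) u
      = condMean {b₀} (fun U => windowDensity {b₀} u₀ S U * Real.exp (-β * wilsonAction w U))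
            (fun U => f (U b₀)) u'
        - condMean {b₀} (fun U => windowDensity {b₀} u₀ S U * Real.exp (-β * wilsonAction w U))
            (fun U => f (U b₀)) u := by
  rw [condMean_oneLink_eq_singleton hdis hS hhm hb₀ f, condMean_oneLink_eq_singleton hdis hS hhm hb₀ f]

/-- … and it VANISHES between exteriors with the same datum at `b₀` (e.g. `u'` = `u` modified anywhere off the
staples of `b₀`). [folklore] -/
theorem condMean_oneLink_sub_eq_zero (hdis : PlaqDisjoint s) (hS : 0 < S)
    (hhm : Measurable fun U : GaugeField P j SU2 => -β * wilsonAction w U) {b₀ : PBond P j} (hb₀ : b₀ ∈ s)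
    (f : SU2 → ℝ) {u' : GaugeField P j SU2} (hD : wilsonDatum (-β) w u' b₀ = wilsonDatum (-β) w u b₀) :
    condMean s (fun U => windowDensity s u₀ S U * Real.exp (-β * wilsonAction w U)) (fun U => f (U b₀)) u'
        - condMean s (fun U => windowDensity s u₀ S U * Real.exp (-β * wilsonAction w U)) (fun U => f (U b₀)) u
      = 0 :=
  sub_eq_zero.2 (condMean_oneLink_congr hdis hS hhm hb₀ f hD)

/-! ## §6  Named instances on the transverse parity classes of `T4PlaqDisjointFamilies` -/

/-- On a parity class `dirClass μ₀ c` (plaquette-disjoint, `#Site/2` links for `d ≥ 2`): product inserts over any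
sub-family factorise into one-link conditional means. [folklore] -/
theorem condMean_prod_dirClass (μ₀ : Fin P.d) (c : ZMod 2) (hS : 0 < S)
    (hhm : Measurable fun U : GaugeField P j SU2 => -β * wilsonAction w U) {t : Finset (PBond P j)}
    (ht : t ⊆ dirClass μ₀ c) (f : PBond P j → SU2 → ℝ) :
    condMean (dirClass μ₀ c) (fun U => windowDensity (dirClass μ₀ c) u₀ S U * Real.exp (-β * wilsonAction w U))
        (fun U => ∏ b ∈ t, f b (U b)) u
      = ∏ b ∈ t, condMean (dirClass μ₀ c)
          (fun U => windowDensity (dirClass μ₀ c) u₀ S U * Real.exp (-β * wilsonAction w U))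
          (fun U => f b (U b)) u :=
  condMean_prod_eq_prod_condMean (plaqDisjoint_dirClass μ₀ c) hS hhm ht f

/-- On a parity class: a one-link insert's conditional mean is its singleton-fibre conditional mean. [folklore] -/
theorem condMean_oneLink_dirClass (μ₀ : Fin P.d) (c : ZMod 2) (hS : 0 < S)
    (hhm : Measurable fun U : GaugeField P j SU2 => -β * wilsonAction w U) {b₀ : PBond P j}
    (hb₀ : b₀ ∈ dirClass μ₀ c) (f : SU2 → ℝ) :
    condMean (dirClass μ₀ c) (fun U => windowDensity (dirClass μ₀ c) u₀ S U * Real.exp (-β * wilsonAction w U))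
        (fun U => f (U b₀)) u
      = condMean {b₀} (fun U => windowDensity {b₀} u₀ S U * Real.exp (-β * wilsonAction w U))
          (fun U => f (U b₀)) u :=
  condMean_oneLink_eq_singleton (plaqDisjoint_dirClass μ₀ c) hS hhm hb₀ f

end Fibre

end Literature.MathematicalPhysics.QuantumFieldTheory.Balaban1983to89.T4WilsonDisjointFactor
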